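import Literature.Analysis.FunctionSpaces.PV1Model
import HarnessLib

/-!
# Models of `PV₁`: parity, `MSP`, comparison and definition by cases

Second layer of the in-model toolkit for the model-theoretic proof of
`S2PV_one_isConservativeOver_PV1` (Buss 1986, Ch. 6; Krajíček 1995, §5.3, Thm. 7.6.3), on top of
`PV1Model.lean`.  For the `PV` symbols of `PVPrograms.lean` — whose specifications there are
identities of `PVFun.eval` on `ℕ` — we prove the specifications **in every model of `PV₁`**,
by open `PIND` (`IsQFPVDef.bitInd`) from the defining equations:

* numerals and combinators (`papp_ap₁/₂/₃`, `papp_zero'/one'/two'`, `papp_wk`), definition by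
  cases on zero (`pcond_of_ne_zero`), definability helpers (`isPVTermFn_app1/2/3`, …);
* parity `par` (`par_zero`, `par_pbit`, `par_cases`: `x = s_{par x} ⌊x/2⌋`);
* `mspLen (x, u) = ⌊x / 2^{|u|}⌋`: the recursion equations without truncation (`msp_zero`,
  `msp_pbit`), `⌊·/2⌋` commutes with `mspLen` (`mHalf_msp`), the **length law**
  `|mspLen (x,u)| + |u| = |x|` for `|u| ≤ |x|` and `mspLen (x,u) = 0` for `|x| ≤ |u|`
  (`msp_length_law`, `msp_eq_zero_iff`, `msp_self`), and `mspLen ∘ mspLen` commutes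
  (`msp_msp_comm`);
* **the three-valued comparison `cmp` is correct** (`c3_spec` — the invariant of Cook's
  bit-by-bit comparison along aligned prefixes — and `cmp_spec`, `cmp_eq_zero/one/two_iff`),
  hence the indicators `leInd`, `eqInd`, `ltInd` and **definition by cases on `≤`**
  (`papp_sel`) have their intended meaning in every model of `PV₁` (Cook 1975, §2: `LESS` and
  the conditional are derived functions of `PV` with provable defining properties; Krajíček 1995,
  §5.3: open formulas of `PV₁` have characteristic terms).

These are the facts by which, in `PV₁`, every open formula becomes an equation `t = 0`, the
first step of Buss's analysis of `PV₁` (Buss 1986, §6.1).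

## References

* S. A. Cook, *Feasibly constructive proofs and the propositional calculus*, STOC 1975, §2.
* S. R. Buss, *Bounded Arithmetic*, Bibliopolis 1986, §6.1, Ch. 6.
* J. Krajíček, *Bounded Arithmetic, Propositional Logic and Complexity Theory*, CUP 1995, §5.3.

## Design choices

* Same setting as `PV1Model.lean`: `[Language.pv.Structure M]`, the reduct `pvReduct M` as a
  local instance, `[M ⊨ BASIC]` for the algebraic notation, `(hM : M ⊨ PV1)` / `(hD : M ⊨ PVdef)`
  explicit; everything in the namespace `Literature.Analysis.FunctionSpaces.PV1`.
* `msp x u` and `c3 a b y` are reducible abbreviations for the applied symbols; `Tri c u v` codes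
  "`c ∈ {0,1,2}` compares `u` with `v`".
-/

namespace Literature.Analysis.FunctionSpaces

open FirstOrder FirstOrder.Language FirstOrder.Language.BoundedFormula
open Literature.Computability.MetaComplexity Literature.Computability.MetaComplexity.BASICModel

attribute [local instance] pvReduct isExpansionOn_pvReduct

namespace PV1

variable {M : Type} [Language.pv.Structure M] [hB : M ⊨ BASIC] {n : ℕ}

/-! ## Term-building combinators in `M` -/

section Combinators

open PVFun

omit hB in
/-- `ap₁ f t (x̄) = f(t x̄)` in a model of `PVdef`. [folklore] -/
theorem papp_ap₁ (hD : M ⊨ PVdef) (f : PVFun 1) (t : PVFun n) (xs : Fin n → M) :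
    papp (ap₁ f t) xs = papp f ![papp t xs] := by
  rw [ap₁, papp_comp hD]; congr 1; funext i; fin_cases i; rfl

omit hB in
/-- `ap₂ f t u (x̄) = f(t x̄, u x̄)` in a model of `PVdef`. [folklore] -/
theorem papp_ap₂ (hD : M ⊨ PVdef) (f : PVFun 2) (t u : PVFun n) (xs : Fin n → M) :
    papp (ap₂ f t u) xs = papp f ![papp t xs, papp u xs] := by
  rw [ap₂, papp_comp hD]; congr 1; funext i; fin_cases i <;> rfl

omit hB in
/-- `ap₃ f t u w (x̄) = f(t x̄, u x̄, w x̄)` in a model of `PVdef`. [folklore] -/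
theorem papp_ap₃ (hD : M ⊨ PVdef) (f : PVFun 3) (t u w : PVFun n) (xs : Fin n → M) :
    papp (ap₃ f t u w) xs = papp f ![papp t xs, papp u xs, papp w xs] := by
  rw [ap₃, papp_comp hD]; congr 1; funext i; fin_cases i <;> rfl

/-- The numeral `zero'` denotes `0`. [folklore] -/
@[simp] theorem papp_zero' (hD : M ⊨ PVdef) (xs : Fin n → M) : papp (zero' : PVFun n) xs = 0 := by
  rw [zero', papp_comp hD, papp_zero, mZero_eq]

/-- The numeral `one' = s₁ 0` denotes `1`. [folklore] -/
@[simp] theorem papp_one' (hD : M ⊨ PVdef) (xs : Fin n → M) : papp (one' : PVFun n) xs = 1 := by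
  rw [one', papp_ap₁ hD, papp_zero' hD]
  change pbit true (0 : M) = 1
  rw [pbit_true_eq hD, mul_zero, zero_add]

/-- The numeral `two' = s₀ (s₁ 0)` denotes `2`. [folklore] -/
@[simp] theorem papp_two' (hD : M ⊨ PVdef) (xs : Fin n → M) : papp (two' : PVFun n) xs = 2 := by
  rw [two', papp_ap₁ hD, papp_one' hD]
  change pbit false (1 : M) = 2
  rw [pbit_false_eq hD, mul_one]

omit hB in
/-- Weakening ignores the last argument. [folklore] -/
@[simp] theorem papp_wk (hD : M ⊨ PVdef) (f : PVFun n) (xs : Fin n → M) (a : M) :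
    papp (wk f) (Fin.snoc xs a) = papp f xs := by
  rw [wk, papp_comp hD]; congr 1; funext i; rw [papp_proj hD]; simp

/-- `1 = s₁ 0`. [folklore] -/
theorem one_eq_pbit (hD : M ⊨ PVdef) : (1 : M) = pbit true 0 := by
  rw [pbit_true_eq hD, mul_zero, zero_add]

/-- `2 = s₀ 1`. [folklore] -/
theorem two_eq_pbit (hD : M ⊨ PVdef) : (2 : M) = pbit false 1 := by
  rw [pbit_false_eq hD, mul_one]

/-- `1 ≠ 0` in `M`. [folklore] -/
theorem one_ne_zero'' : (1 : M) ≠ 0 := one_ne_zero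

/-- `2 ≠ 0` in `M`. [folklore] -/
theorem two_ne_zero'' : (2 : M) ≠ 0 := by
  rw [← one_add_one_eq_two]; exact ne_bot_of_gt (lt_add_one' (1 : M))

/-- `2 ≠ 1` in `M`. [folklore] -/
theorem two_ne_one'' : (2 : M) ≠ 1 := by
  rw [← one_add_one_eq_two]; exact (ne_add_one (1 : M)).symm

/-- `1 ≤ 2` in `M`. [folklore] -/
theorem one_le_two'' : (1 : M) ≤ 2 := by
  rw [← one_add_one_eq_two]; exact le_add_right'' _ _

/-- `⌊1/2⌋ = 0`. [folklore] -/
@[simp] theorem mHalf_one (hD : M ⊨ PVdef) : mHalf (1 : M) = 0 := by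
  rw [one_eq_pbit hD, mHalf_pbit hD]

/-- `⌊2/2⌋ = 1`. [folklore] -/
@[simp] theorem mHalf_two (hD : M ⊨ PVdef) : mHalf (2 : M) = 1 := by
  rw [two_eq_pbit hD, mHalf_pbit hD]

/-- `cond (x, y, z) = z` for `x ≠ 0`. [cite: Cobham1965] -/
theorem pcond_of_ne_zero (hD : M ⊨ PVdef) {x : M} (hx : x ≠ 0) (y z : M) : pcond x y z = z := by
  obtain ⟨b, hxb, hne⟩ := exists_eq_pbit_mHalf hD x hx
  rw [hxb]; exact pcond_pbit hD b _ y z hne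

/-- `cond (x, y, z)` by cases. [cite: Cobham1965] -/
theorem pcond_eq_ite (hD : M ⊨ PVdef) (x y z : M) [Decidable (x = 0)] :
    pcond x y z = if x = 0 then y else z := by
  split_ifs with h
  · rw [h, pcond_zero hD]
  · exact pcond_of_ne_zero hD h y z

end Combinators

/-! ## Definability helpers for symbols applied to vector literals -/

section DefHelpers

variable {m : ℕ} {F G H : (Fin m → M) → M}

omit hB in
/-- A unary symbol applied to a term function. [folklore] -/
theorem isPVTermFn_app1 (f : PVFun 1) (hF : IsPVTermFn F) : IsPVTermFn fun xs => papp f ![F xs] :=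
  (IsPVTermFn.app f (F := ![F]) fun i => by fin_cases i; exact hF).of_eq fun xs => by
    congr 1; funext i; fin_cases i; rfl

omit hB in
/-- A binary symbol applied to term functions. [folklore] -/
theorem isPVTermFn_app2 (f : PVFun 2) (hF : IsPVTermFn F) (hG : IsPVTermFn G) :
    IsPVTermFn fun xs => papp f ![F xs, G xs] :=
  (IsPVTermFn.app f (F := ![F, G]) fun i => by fin_cases i <;> assumption).of_eq fun xs => by
    congr 1; funext i; fin_cases i <;> rfl

omit hB in
/-- A ternary symbol applied to term functions. [folklore] -/
theorem isPVTermFn_app3 (f : PVFun 3) (hF : IsPVTermFn F) (hG : IsPVTermFn G) (hH : IsPVTermFn H) :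
    IsPVTermFn fun xs => papp f ![F xs, G xs, H xs] :=
  (IsPVTermFn.app f (F := ![F, G, H]) fun i => by fin_cases i <;> assumption).of_eq fun xs => by
    congr 1; funext i; fin_cases i <;> rfl

omit hB in
/-- A symbol applied to `Fin.snoc (Fin.snoc c (F xs)) (G xs)` (parameters `c`, two term
functions) is a term function. [folklore] -/
theorem isPVTermFn_app_snoc2 {q : ℕ} (f : PVFun (q + 2)) (c : Fin q → M) (hF : IsPVTermFn F)
    (hG : IsPVTermFn G) :
    IsPVTermFn fun xs => papp f (Fin.snoc (Fin.snoc c (F xs)) (G xs)) := by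
  refine (IsPVTermFn.app f
    (F := fun i xs => (Fin.snoc (Fin.snoc c (F xs) : Fin (q + 1) → M) (G xs) : Fin (q + 2) → M) i)
    fun i => ?_).of_eq fun xs => rfl
  cases i using Fin.lastCases with
  | last => simpa using hG
  | cast i =>
    cases i using Fin.lastCases with
    | last => simpa using hF
    | cast i => simpa using IsPVTermFn.const (c i)

omit hB in
/-- A symbol applied to `Fin.snoc c (F xs)` (parameters `c`, one term function). [folklore] -/
theorem isPVTermFn_app_snoc1 {q : ℕ} (f : PVFun (q + 1)) (c : Fin q → M) (hF : IsPVTermFn F) :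
    IsPVTermFn fun xs => papp f (Fin.snoc c (F xs)) := by
  refine (IsPVTermFn.app f (F := fun i xs => (Fin.snoc c (F xs) : Fin (q + 1) → M) i)
    fun i => ?_).of_eq fun xs => rfl
  cases i using Fin.lastCases with
  | last => simpa using hF
  | cast i => simpa using IsPVTermFn.const (c i)

omit hB in
/-- The variable of a unary predicate is a term function (`v ↦ v 0`). [folklore] -/
theorem isPVTermFn_v0 : IsPVTermFn fun v : Fin 1 → M => v 0 := IsPVTermFn.proj 0

end DefHelpers

/-! ## Parity -/

section Par

open PVFun

/-- `par 0 = 0`. [cite: Cook1975, §2] -/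
@[simp] theorem par_zero (hD : M ⊨ PVdef) : papp par ![(0 : M)] = 0 := by
  have h := papp_limRec_zero hD PVFun.zero (fun b => bif b then one' else zero') one'
    (![] : Fin 0 → M)
  have e : (Fin.snoc (![] : Fin 0 → M) 0 : Fin 1 → M) = ![0] := by funext i; fin_cases i; rfl
  rw [e] at h
  rw [par, h, papp_zero, papp_one' hD, mZero_eq]
  exact min_eq_left bot_le

/-- `par (s_b y) = b` for `s_b y ≠ 0`. [cite: Cook1975, §2] -/
theorem par_pbit (hD : M ⊨ PVdef) {b : Bool} {y : M} (hy : pbit b y ≠ 0) :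
    papp par ![pbit b y] = bitVal b := by
  have h := papp_limRec_bit hD b PVFun.zero (fun b => bif b then one' else zero') one'
    (![] : Fin 0 → M) y hy
  have e : ∀ z : M, (Fin.snoc (![] : Fin 0 → M) z : Fin 1 → M) = ![z] := fun z => by
    funext i; fin_cases i; rfl
  rw [e, e] at h
  rw [par, h, papp_one' hD]
  cases b
  · simp only [bitVal, cond_false, papp_zero' hD, Bool.false_eq_true, if_false]
    exact min_eq_left bot_le
  · simp only [bitVal, cond_true, papp_one' hD, if_true, min_self]

/-- **Parity and notation**: `x = s_{par x} ⌊x/2⌋`; precisely, either `x = 0 ∧ par x = 0`, or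
`par x = 0 ∧ x = s₀ ⌊x/2⌋ ≠ 0`, or `par x = 1 ∧ x = s₁ ⌊x/2⌋`. [cite: Cook1975, §2] -/
theorem par_cases (hD : M ⊨ PVdef) (x : M) :
    (x = 0 ∧ papp par ![x] = 0) ∨
      (papp par ![x] = 0 ∧ x = pbit false (mHalf x) ∧ pbit false (mHalf x) ≠ 0) ∨
      (papp par ![x] = 1 ∧ x = pbit true (mHalf x)) := by
  rcases eq_zero_or_eq_pbit hD x with rfl | ⟨b, hx, hne⟩
  · exact Or.inl ⟨rfl, par_zero hD⟩
  · cases b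
    · refine Or.inr (Or.inl ⟨?_, hx, hne⟩)
      rw [hx, par_pbit hD hne]; rfl
    · refine Or.inr (Or.inr ⟨?_, hx⟩)
      rw [hx, par_pbit hD hne]; rfl

end Par

/-! ## `MSP` by a length: `mspLen (x, u) = ⌊x / 2^{|u|}⌋` -/

section MspLen

open PVFun

/-- Notation: `msp x u := mspLen (x, u)` in `M`. [cite: Buss1986, Ch. 6] -/
abbrev msp (x u : M) : M := papp mspLen ![x, u]

omit [Language.pv.Structure M] hB in
/-- `Fin.snoc ![x] u = ![x, u]`. [folklore] -/
theorem snoc_vec1' (x u : M) : (Fin.snoc ![x] u : Fin 2 → M) = ![x, u] := by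
  funext i; fin_cases i <;> rfl

omit [Language.pv.Structure M] hB in
/-- `Fin.snoc ![x, u] r = ![x, u, r]`. [folklore] -/
theorem snoc_vec2' (x u r : M) : (Fin.snoc ![x, u] r : Fin 3 → M) = ![x, u, r] := by
  funext i; fin_cases i <;> rfl

omit [Language.pv.Structure M] hB in
/-- `Fin.snoc ![x, u, r] s = ![x, u, r, s]`. [folklore] -/
theorem snoc_vec3' (x u r s : M) : (Fin.snoc ![x, u, r] s : Fin 4 → M) = ![x, u, r, s] := by
  funext i; fin_cases i <;> rfl

/-- `mspLen (x, u) ≤ x`. [cite: Buss1986, Ch. 6] -/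
theorem msp_le (hD : M ⊨ PVdef) (x u : M) : msp x u ≤ x := by
  have h := papp_limRec_le hD (proj 0) (fun _ => ap₁ half (proj (Fin.last 2))) (proj 0) ![x] u
  rw [snoc_vec1', papp_proj hD] at h
  exact h

/-- `mspLen (x, 0) = x`. [cite: Buss1986, Ch. 6] -/
@[simp] theorem msp_zero (hD : M ⊨ PVdef) (x : M) : msp x 0 = x := by
  have h := papp_limRec_zero hD (proj 0) (fun _ => ap₁ half (proj (Fin.last 2))) (proj 0) ![x]
  rw [snoc_vec1', papp_proj hD, papp_proj hD] at h
  rw [msp, mspLen, h]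
  exact min_eq_left le_rfl

/-- `mspLen (x, s_b u) = ⌊mspLen (x, u) / 2⌋` for `s_b u ≠ 0` (no truncation: the value stays
below the bound `x`). [cite: Buss1986, Ch. 6] -/
theorem msp_pbit (hD : M ⊨ PVdef) (x : M) {b : Bool} {u : M} (hu : pbit b u ≠ 0) :
    msp x (pbit b u) = mHalf (msp x u) := by
  have h := papp_limRec_bit hD b (proj 0) (fun _ => ap₁ half (proj (Fin.last 2))) (proj 0) ![x]
    u hu
  rw [snoc_vec1', snoc_vec1', snoc_vec2', papp_proj hD, papp_ap₁ hD, papp_proj hD,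
    papp_half] at h
  rw [msp, mspLen, h]
  exact min_eq_left ((mHalf_le _).trans (msp_le hD x u))

/-- `mspLen (0, u) = 0`. [folklore] -/
@[simp] theorem msp_zero_left (hD : M ⊨ PVdef) (u : M) : msp 0 u = 0 :=
  le_antisymm (msp_le hD 0 u) bot_le

/-- **`⌊·/2⌋` commutes with `mspLen`**: `⌊mspLen (x, u)/2⌋ = mspLen (⌊x/2⌋, u)` (both are
`⌊x / 2^{|u|+1}⌋`; open `PIND` on `u`). [cite: Buss1986, Ch. 6] -/
theorem mHalf_msp (hM : M ⊨ PV1) (x u : M) : mHalf (msp x u) = msp (mHalf x) u := by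
  have hD := model_PVdef_of_model_PV1 hM
  refine IsQFPVDef.bitInd hM (P := fun u => mHalf (msp x u) = msp (mHalf x) u) ?_ ?_ ?_ u
  · exact IsQFPVDef.eq ((isPVTermFn_app2 _ (IsPVTermFn.const x) isPVTermFn_v0).half)
      (isPVTermFn_app2 _ (IsPVTermFn.const _) isPVTermFn_v0)
  · simp only [msp_zero hD]
  · intro b u hu ih
    rw [msp_pbit hD x hu, msp_pbit hD (mHalf x) hu, ih]

/-- **The length law of `mspLen`**: if `|u| ≤ |x|` then `|mspLen (x, u)| + |u| = |x|`, and if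
`|x| ≤ |u|` then `mspLen (x, u) = 0` (open `PIND` on `u`). [cite: Buss1986, Ch. 6] -/
theorem msp_length_law (hM : M ⊨ PV1) (x u : M) :
    (mLen u ≤ mLen x → mLen (msp x u) + mLen u = mLen x) ∧ (mLen x ≤ mLen u → msp x u = 0) := by
  have hD := model_PVdef_of_model_PV1 hM
  refine IsQFPVDef.bitInd hM
    (P := fun u => (mLen u ≤ mLen x → mLen (msp x u) + mLen u = mLen x) ∧
      (mLen x ≤ mLen u → msp x u = 0)) ?_ ?_ ?_ u
  · refine IsQFPVDef.and (IsQFPVDef.imp ?_ ?_) (IsQFPVDef.imp ?_ ?_)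
    · exact IsQFPVDef.le' isPVTermFn_v0.len (IsPVTermFn.const x).len
    · exact IsQFPVDef.eq ((isPVTermFn_app2 _ (IsPVTermFn.const x) isPVTermFn_v0).len.add
        isPVTermFn_v0.len) (IsPVTermFn.const x).len
    · exact IsQFPVDef.le' (IsPVTermFn.const x).len isPVTermFn_v0.len
    · exact IsQFPVDef.eq (isPVTermFn_app2 _ (IsPVTermFn.const x) isPVTermFn_v0)
        IsPVTermFn.zero
  · refine ⟨fun _ => ?_, fun h => ?_⟩
    · rw [msp_zero hD, (mLen_eq_zero_iff (0 : M)).2 rfl, add_zero]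
    · rw [(mLen_eq_zero_iff (0 : M)).2 rfl] at h
      have hx : x = 0 := (mLen_eq_zero_iff x).1 (le_antisymm h bot_le)
      rw [msp_zero hD, hx]
  · rintro b u hu ⟨ih1, ih2⟩
    rw [mLen_pbit hD hu, msp_pbit hD x hu]
    refine ⟨fun h => ?_, fun h => ?_⟩
    · have hle : mLen u ≤ mLen x := (le_add_right'' _ _).trans h
      have e := ih1 hle
      have hm : 1 ≤ mLen (msp x u) := by
        have : mLen u + 1 ≤ mLen u + mLen (msp x u) := by
          rw [add_comm (mLen u) (mLen (msp x u)), e]; exact h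
        exact le_of_add_le_add_left this
      have hne : msp x u ≠ 0 := fun h0 => by
        rw [h0, (mLen_eq_zero_iff (0 : M)).2 rfl] at hm
        exact absurd hm (not_le.2 zero_lt_one)
      rw [← e, mLen_eq_mLen_mHalf_add_one hne, add_assoc, add_comm 1 (mLen u)]
    · rcases le_or_gt (mLen x) (mLen u) with hle | hlt
      · rw [ih2 hle, mHalf_zero' hD]
      · have heq : mLen x = mLen u + 1 := le_antisymm h ((add_one_le_iff' _ _).2 hlt)
        have e := ih1 hlt.le
        rw [heq, add_comm (mLen u)] at e
        have h1 : mLen (msp x u) = 1 := add_right_cancel e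
        have hne : msp x u ≠ 0 := fun h0 => by
          rw [h0, (mLen_eq_zero_iff (0 : M)).2 rfl] at h1
          exact zero_ne_one h1
        rw [mLen_eq_mLen_mHalf_add_one hne] at h1
        have h0 : mLen (mHalf (msp x u)) = 0 := by
          have : mLen (mHalf (msp x u)) + 1 = 0 + 1 := by rw [zero_add]; exact h1
          exact add_right_cancel this
        exact (mLen_eq_zero_iff _).1 h0

/-- `mspLen (x, u) = 0 ↔ |x| ≤ |u|`. [cite: Buss1986, Ch. 6] -/
theorem msp_eq_zero_iff (hM : M ⊨ PV1) (x u : M) : msp x u = 0 ↔ mLen x ≤ mLen u := by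
  refine ⟨fun h => ?_, (msp_length_law hM x u).2⟩
  by_contra hlt
  rw [not_le] at hlt
  have e := (msp_length_law hM x u).1 hlt.le
  rw [h, (mLen_eq_zero_iff (0 : M)).2 rfl, zero_add] at e
  exact absurd hlt (by rw [e]; exact lt_irrefl _)

/-- `|mspLen (x, u)| + |u| = |x|` when `|u| ≤ |x|`. [cite: Buss1986, Ch. 6] -/
theorem mLen_msp_add (hM : M ⊨ PV1) {x u : M} (h : mLen u ≤ mLen x) :
    mLen (msp x u) + mLen u = mLen x :=
  (msp_length_law hM x u).1 h

/-- `mspLen (x, x) = 0`. [cite: Buss1986, Ch. 6] -/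
@[simp] theorem msp_self (hM : M ⊨ PV1) (x : M) : msp x x = 0 :=
  (msp_eq_zero_iff hM x x).2 le_rfl

/-- `mspLen (x, u) ≠ 0` when `|u| < |x|`. [folklore] -/
theorem msp_ne_zero_of_lt (hM : M ⊨ PV1) {x u : M} (h : mLen u < mLen x) : msp x u ≠ 0 :=
  fun h0 => absurd ((msp_eq_zero_iff hM x u).1 h0) (not_le.2 h)

/-- **`mspLen`'s commute**: `mspLen (mspLen (x, u), v) = mspLen (mspLen (x, v), u)` (both drop
`|u| + |v|` bits; open `PIND` on `v`). [folklore] -/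
theorem msp_msp_comm (hM : M ⊨ PV1) (x u v : M) : msp (msp x u) v = msp (msp x v) u := by
  have hD := model_PVdef_of_model_PV1 hM
  refine IsQFPVDef.bitInd hM (P := fun v => msp (msp x u) v = msp (msp x v) u) ?_ ?_ ?_ v
  · exact IsQFPVDef.eq (isPVTermFn_app2 _ (IsPVTermFn.const _) isPVTermFn_v0)
      (isPVTermFn_app2 _ (isPVTermFn_app2 _ (IsPVTermFn.const x) isPVTermFn_v0)
        (IsPVTermFn.const u))
  · simp only [msp_zero hD]
  · intro b v hv ih
    rw [msp_pbit hD _ hv, msp_pbit hD x hv, ih, mHalf_msp hM]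

end MspLen


/-! ## Three-valued comparison -/

section Cmp

open PVFun

/-- `cond (x, y, z) ∈ {y, z}`. [cite: Cobham1965] -/
theorem pcond_eq_or (hD : M ⊨ PVdef) (x y z : M) : pcond x y z = y ∨ pcond x y z = z := by
  classical
  rw [pcond_eq_ite hD]; split_ifs
  · exact Or.inl rfl
  · exact Or.inr rfl

/-- The trichotomy predicate coded by `0 / 1 / 2`: "`c` compares `u` with `v`". [folklore] -/
def Tri (c u v : M) : Prop := (c = 0 ∧ u = v) ∨ (c = 1 ∧ u < v) ∨ (c = 2 ∧ v < u)

/-- `Tri` of term functions is open-definable. [folklore] -/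
theorem isQFPVDef_tri {m : ℕ} {C U V : (Fin m → M) → M} (hC : IsPVTermFn C) (hU : IsPVTermFn U)
    (hV : IsPVTermFn V) : IsQFPVDef fun xs => Tri (C xs) (U xs) (V xs) :=
  ((IsQFPVDef.eq hC IsPVTermFn.zero).and (IsQFPVDef.eq hU hV)).or
    (((IsQFPVDef.eq hC IsPVTermFn.one).and (IsQFPVDef.lt' hU hV)).or
      ((IsQFPVDef.eq hC IsPVTermFn.two).and (IsQFPVDef.lt' hV hU)))

/-- Notation: `c3 a b y := cmp3 (a, b, y)` in `M`. [cite: Cook1975, §2] -/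
abbrev c3 (a b y : M) : M := papp cmp3 ![a, b, y]

omit hB in
/-- `pfx (a, b, y) = mspLen (b, mspLen (a, y))` in `M`. [folklore] -/
theorem papp_pfx (hD : M ⊨ PVdef) (a b y : M) : papp pfx ![a, b, y] = msp b (msp a y) := by
  rw [pfx, papp_ap₂ hD, papp_ap₂ hD, papp_proj hD, papp_proj hD, papp_proj hD]; rfl

/-- The comparison steps take values `≤ 2`. [folklore] -/
theorem papp_cmpStep_le_two (hD : M ⊨ PVdef) (i : Bool) (v : Fin 4 → M) :
    papp (bif i then cmpStepT else cmpStepF) v ≤ 2 := by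
  cases i
  · simp only [cond_false, cmpStepF, papp_ap₃ hD, papp_zero' hD, papp_one' hD]
    show pcond _ 0 1 ≤ 2
    rcases pcond_eq_or hD (papp (par.ap₁ (pfx.ap₃ (proj 0) (proj 1) ((bit false).ap₁ (proj 2)))) v)
      (0 : M) 1 with h | h <;> rw [h]
    · exact bot_le
    · exact one_le_two''
  · simp only [cond_true, cmpStepT, papp_ap₃ hD, papp_zero' hD, papp_two' hD]
    show pcond _ 2 0 ≤ 2
    rcases pcond_eq_or hD (papp (par.ap₁ (pfx.ap₃ (proj 0) (proj 1) ((bit true).ap₁ (proj 2)))) v)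
      (2 : M) 0 with h | h <;> rw [h]
    exact bot_le

/-- Semantics of the comparison steps: `step_F (a,b,y,r) = cond (par Q, 0, 1)` and
`step_T (a,b,y,r) = cond (par Q, 2, 0)` with `Q = pfx (a, b, s_i y)`. [folklore] -/
theorem papp_cmpStep (hD : M ⊨ PVdef) (i : Bool) (a b y r : M) :
    papp (bif i then cmpStepT else cmpStepF) ![a, b, y, r] =
      if i then pcond (papp par ![msp b (msp a (pbit i y))]) 2 0
      else pcond (papp par ![msp b (msp a (pbit i y))]) 0 1 := by
  cases i
  · simp only [cond_false, cmpStepF, papp_ap₃ hD, papp_ap₁ hD, papp_proj hD, papp_zero' hD,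
      papp_one' hD, Bool.false_eq_true, ↓reduceIte, Matrix.cons_val_zero, Matrix.cons_val_one,
      Matrix.cons_val, papp_pfx hD]
  · simp only [cond_true, cmpStepT, papp_ap₃ hD, papp_ap₁ hD, papp_proj hD, papp_zero' hD,
      papp_two' hD, ↓reduceIte, Matrix.cons_val_zero, Matrix.cons_val_one, Matrix.cons_val,
      papp_pfx hD]

/-- `cmp3 ≤ 2`. [folklore] -/
theorem c3_le_two (hD : M ⊨ PVdef) (a b y : M) : c3 a b y ≤ 2 := by
  have h := papp_limRec_le hD (ap₃ cond (ap₂ mspLen (proj 1) (proj 0)) zero' one')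
    (fun i => ap₃ cond (proj (Fin.last 3)) (bif i then cmpStepT else cmpStepF) (proj (Fin.last 3)))
    two' ![a, b] y
  rw [snoc_vec2', papp_two' hD] at h
  exact h

/-- Base of `cmp3`: `cmp3 (a, b, 0) = cond (mspLen (b, a), 0, 1)`. [cite: Cook1975, §2] -/
theorem c3_zero (hD : M ⊨ PVdef) (a b : M) : c3 a b 0 = pcond (msp b a) 0 1 := by
  have h := papp_limRec_zero hD (ap₃ cond (ap₂ mspLen (proj 1) (proj 0)) zero' one')
    (fun i => ap₃ cond (proj (Fin.last 3)) (bif i then cmpStepT else cmpStepF) (proj (Fin.last 3)))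
    two' ![a, b]
  rw [snoc_vec2', papp_two' hD, papp_ap₃ hD, papp_ap₂ hD, papp_proj hD, papp_proj hD,
    papp_zero' hD, papp_one' hD] at h
  rw [c3, cmp3, h]
  refine min_eq_left ?_
  show pcond (msp b a) 0 1 ≤ 2
  rcases pcond_eq_or hD (msp b a) (0 : M) 1 with e | e <;> rw [e]
  · exact bot_le
  · exact one_le_two''

/-- Step of `cmp3`: `cmp3 (a, b, s_i y) = cond (r, step_i (a,b,y,r), r)` with `r = cmp3 (a,b,y)`,
for `s_i y ≠ 0`. [cite: Cook1975, §2] -/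
theorem c3_pbit (hD : M ⊨ PVdef) (a b : M) {i : Bool} {y : M} (hy : pbit i y ≠ 0) :
    c3 a b (pbit i y) =
      pcond (c3 a b y) (papp (bif i then cmpStepT else cmpStepF) ![a, b, y, c3 a b y])
        (c3 a b y) := by
  have h := papp_limRec_bit hD i (ap₃ cond (ap₂ mspLen (proj 1) (proj 0)) zero' one')
    (fun i => ap₃ cond (proj (Fin.last 3)) (bif i then cmpStepT else cmpStepF) (proj (Fin.last 3)))
    two' ![a, b] y hy
  rw [snoc_vec2', snoc_vec2', snoc_vec3', papp_two' hD, papp_ap₃ hD, papp_proj hD] at h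
  rw [c3, cmp3, h]
  refine min_eq_left ?_
  show pcond (c3 a b y) (papp (bif i then cmpStepT else cmpStepF) ![a, b, y, c3 a b y])
    (c3 a b y) ≤ 2
  rcases pcond_eq_or hD (c3 a b y) (papp (bif i then cmpStepT else cmpStepF) ![a, b, y, c3 a b y])
    (c3 a b y) with e | e <;> rw [e]
  · exact papp_cmpStep_le_two hD i _
  · exact c3_le_two hD a b y

/-- **Correctness of `cmp3` on aligned prefixes**: for `|y| ≤ |a|`, `cmp3 (a, b, y)` compares
`y` with `⌊b / 2^{|a| - |y|}⌋ = mspLen (b, mspLen (a, y))` (open `PIND` on `y`).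
[cite: Cook1975, §2] -/
theorem c3_spec (hM : M ⊨ PV1) (a b y : M) (hy : mLen y ≤ mLen a) :
    Tri (c3 a b y) y (msp b (msp a y)) := by
  have hD := model_PVdef_of_model_PV1 hM
  revert hy
  refine IsQFPVDef.bitInd hM
    (P := fun y => mLen y ≤ mLen a → Tri (c3 a b y) y (msp b (msp a y))) ?_ ?_ ?_ y
  · refine IsQFPVDef.imp (IsQFPVDef.le' isPVTermFn_v0.len (IsPVTermFn.const a).len) ?_
    exact isQFPVDef_tri (isPVTermFn_app3 _ (IsPVTermFn.const a) (IsPVTermFn.const b)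
      isPVTermFn_v0) isPVTermFn_v0 (isPVTermFn_app2 _ (IsPVTermFn.const b)
        (isPVTermFn_app2 _ (IsPVTermFn.const a) isPVTermFn_v0))
  · intro _
    rw [c3_zero hD, msp_zero hD]
    by_cases h0 : msp b a = 0
    · rw [h0, pcond_zero hD]; exact Or.inl ⟨rfl, rfl⟩
    · rw [pcond_of_ne_zero hD h0]
      exact Or.inr (Or.inl ⟨rfl, (pos_iff_ne_zero' _).2 h0⟩)
  · intro i y hne ih h
    rw [mLen_pbit hD hne] at h
    have hlt : mLen y < mLen a := (add_one_le_iff' _ _).1 h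
    have IH := ih hlt.le
    have hu : msp a y ≠ 0 := msp_ne_zero_of_lt hM hlt
    obtain ⟨c, hu', hcne⟩ := exists_eq_pbit_mHalf hD _ hu
    -- the new aligned prefix `Q` and its relation to the old one
    set Q := msp b (mHalf (msp a y)) with hQ
    have hPy : msp b (msp a y) = mHalf Q := by
      conv_lhs => rw [hu']
      rw [msp_pbit hD b hcne]
    have hnew : msp b (msp a (pbit i y)) = Q := by rw [msp_pbit hD a hne]
    rw [hnew, c3_pbit hD a b hne, papp_cmpStep hD, hnew]
    rw [hPy] at IH
    -- `Q` in notation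
    have hQnot : Q ≠ 0 → ∃ d : Bool, Q = pbit d (mHalf Q) ∧ pbit d (mHalf Q) ≠ 0 :=
      fun hQ0 => exists_eq_pbit_mHalf hD Q hQ0
    by_cases hr : c3 a b y = 0
    · -- tie so far: compare the new bits
      rw [hr, pcond_zero hD]
      have hyQ : y = mHalf Q := by
        rcases IH with ⟨-, e⟩ | ⟨e, -⟩ | ⟨e, -⟩
        · exact e
        · rw [hr] at e; exact absurd e.symm one_ne_zero''
        · rw [hr] at e; exact absurd e.symm two_ne_zero''
      rcases par_cases hD Q with ⟨hQ0, hp⟩ | ⟨hp, hQe, hQne⟩ | ⟨hp, hQo⟩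
      · -- Q = 0, hence y = 0 and i = true
        rw [hQ0, mHalf_zero' hD] at hyQ
        subst hyQ
        cases i
        · exact absurd (pbit_false_zero hD) hne
        · rw [if_pos rfl, hp, pcond_zero hD, hQ0]
          exact Or.inr (Or.inr ⟨rfl, (pos_iff_ne_zero' _).2 hne⟩)
      · rw [← hyQ] at hQe
        cases i
        · rw [if_neg Bool.false_ne_true, hp, pcond_zero hD]
          exact Or.inl ⟨rfl, hQe.symm⟩
        · rw [if_pos rfl, hp, pcond_zero hD]
          refine Or.inr (Or.inr ⟨rfl, ?_⟩)
          rw [hQe]; exact (pbit_lt_pbit_iff hD false true y y).2 (Or.inr ⟨rfl, rfl, rfl⟩)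
      · rw [← hyQ] at hQo
        cases i
        · rw [if_neg Bool.false_ne_true, hp, pcond_of_ne_zero hD one_ne_zero'']
          refine Or.inr (Or.inl ⟨rfl, ?_⟩)
          rw [hQo]; exact (pbit_lt_pbit_iff hD false true y y).2 (Or.inr ⟨rfl, rfl, rfl⟩)
        · rw [if_pos rfl, hp, pcond_of_ne_zero hD one_ne_zero'']
          exact Or.inl ⟨rfl, hQo.symm⟩
    · -- already decided: the decision persists
      rw [pcond_of_ne_zero hD hr]
      rcases IH with ⟨e, -⟩ | ⟨e, hlt'⟩ | ⟨e, hlt'⟩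
      · exact absurd e hr
      · refine Or.inr (Or.inl ⟨e, ?_⟩)
        have hQ0 : Q ≠ 0 := fun h0 => by
          rw [h0, mHalf_zero' hD] at hlt'; exact absurd hlt' bot_le.not_gt
        obtain ⟨d, hQd, -⟩ := hQnot hQ0
        rw [hQd]; exact (pbit_lt_pbit_iff hD i d _ _).2 (Or.inl hlt')
      · refine Or.inr (Or.inr ⟨e, ?_⟩)
        by_cases hQ0 : Q = 0
        · rw [hQ0]; exact (pos_iff_ne_zero' _).2 hne
        · obtain ⟨d, hQd, -⟩ := hQnot hQ0
          rw [hQd]; exact (pbit_lt_pbit_iff hD d i _ _).2 (Or.inl hlt')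

/-- **`cmp` computes the three-valued comparison** in every model of `PV₁`:
`cmp (a, b) = 0 ∧ a = b`, or `= 1 ∧ a < b`, or `= 2 ∧ b < a`. [cite: Cook1975, §2] -/
theorem cmp_spec (hM : M ⊨ PV1) (a b : M) : Tri (papp cmp ![a, b]) a b := by
  have hD := model_PVdef_of_model_PV1 hM
  have e : papp PVFun.cmp ![a, b] = c3 a b a := by
    show papp (comp cmp3 ![proj 0, proj 1, proj 0]) ![a, b] = _
    rw [papp_comp hD]; congr 1; funext j; fin_cases j <;> simp [papp_proj hD]
  have h := c3_spec hM a b a le_rfl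
  rw [msp_self hM, msp_zero hD] at h
  rwa [e]

/-- `cmp (a, b) = 0 ↔ a = b`. [cite: Cook1975, §2] -/
theorem cmp_eq_zero_iff (hM : M ⊨ PV1) (a b : M) : papp cmp ![a, b] = 0 ↔ a = b := by
  rcases cmp_spec hM a b with ⟨e, h⟩ | ⟨e, h⟩ | ⟨e, h⟩ <;> rw [e]
  · exact ⟨fun _ => h, fun _ => rfl⟩
  · exact ⟨fun h1 => absurd h1 one_ne_zero'', fun h2 => absurd h2 h.ne⟩
  · exact ⟨fun h1 => absurd h1 two_ne_zero'', fun h2 => absurd h2.symm h.ne⟩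

/-- `cmp (a, b) = 1 ↔ a < b`. [cite: Cook1975, §2] -/
theorem cmp_eq_one_iff (hM : M ⊨ PV1) (a b : M) : papp cmp ![a, b] = 1 ↔ a < b := by
  rcases cmp_spec hM a b with ⟨e, h⟩ | ⟨e, h⟩ | ⟨e, h⟩ <;> rw [e]
  · exact ⟨fun h1 => absurd h1.symm one_ne_zero'', fun h2 => absurd h h2.ne⟩
  · exact ⟨fun _ => h, fun _ => rfl⟩
  · exact ⟨fun h1 => absurd h1 two_ne_one'', fun h2 => absurd (h.trans h2) (lt_irrefl _)⟩

/-- `cmp (a, b) = 2 ↔ b < a`. [cite: Cook1975, §2] -/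
theorem cmp_eq_two_iff (hM : M ⊨ PV1) (a b : M) : papp cmp ![a, b] = 2 ↔ b < a := by
  rcases cmp_spec hM a b with ⟨e, h⟩ | ⟨e, h⟩ | ⟨e, h⟩ <;> rw [e]
  · exact ⟨fun h1 => absurd h1.symm two_ne_zero'', fun h2 => absurd h h2.ne'⟩
  · exact ⟨fun h1 => absurd h1.symm two_ne_one'', fun h2 => absurd (h.trans h2) (lt_irrefl _)⟩
  · exact ⟨fun _ => h, fun _ => rfl⟩

/-! ### Indicators and definition by cases -/

/-- **`leInd (a, b) = 1` if `a ≤ b`, else `0`**, in every model of `PV₁`. [cite: Cook1975, §2] -/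
theorem papp_leInd (hM : M ⊨ PV1) (a b : M) :
    papp leInd ![a, b] = if a ≤ b then 1 else 0 := by
  have hD := model_PVdef_of_model_PV1 hM
  rw [leInd, papp_ap₃ hD, papp_ap₁ hD, papp_one' hD, papp_zero' hD, papp_half]
  change pcond (mHalf (papp cmp ![a, b])) 1 0 = _
  rcases cmp_spec hM a b with ⟨e, h⟩ | ⟨e, h⟩ | ⟨e, h⟩ <;> rw [e]
  · rw [mHalf_zero' hD, pcond_zero hD, if_pos h.le]
  · rw [mHalf_one hD, pcond_zero hD, if_pos h.le]
  · rw [mHalf_two hD, pcond_of_ne_zero hD one_ne_zero'', if_neg h.not_ge]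

/-- **`eqInd (a, b) = 1` if `a = b`, else `0`**, in every model of `PV₁`. [cite: Cook1975, §2] -/
theorem papp_eqInd (hM : M ⊨ PV1) (a b : M) :
    papp eqInd ![a, b] = if a = b then 1 else 0 := by
  have hD := model_PVdef_of_model_PV1 hM
  rw [eqInd, papp_ap₃ hD, papp_one' hD, papp_zero' hD]
  change pcond (papp cmp ![a, b]) 1 0 = _
  rcases cmp_spec hM a b with ⟨e, h⟩ | ⟨e, h⟩ | ⟨e, h⟩ <;> rw [e]
  · rw [pcond_zero hD, if_pos h]
  · rw [pcond_of_ne_zero hD one_ne_zero'', if_neg h.ne]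
  · rw [pcond_of_ne_zero hD two_ne_zero'', if_neg h.ne']

/-- **`ltInd (a, b) = 1` if `a < b`, else `0`**, in every model of `PV₁`. [cite: Cook1975, §2] -/
theorem papp_ltInd (hM : M ⊨ PV1) (a b : M) :
    papp ltInd ![a, b] = if a < b then 1 else 0 := by
  have hD := model_PVdef_of_model_PV1 hM
  rw [ltInd, papp_ap₃ hD, papp_ap₃ hD, papp_ap₁ hD, papp_one' hD, papp_zero' hD, papp_half]
  change pcond (papp cmp ![a, b]) 0 (pcond (mHalf (papp cmp ![a, b])) 1 0) = _
  rcases cmp_spec hM a b with ⟨e, h⟩ | ⟨e, h⟩ | ⟨e, h⟩ <;> rw [e]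
  · rw [pcond_zero hD, if_neg (h ▸ lt_irrefl _)]
  · rw [pcond_of_ne_zero hD one_ne_zero'', mHalf_one hD, pcond_zero hD, if_pos h]
  · rw [pcond_of_ne_zero hD two_ne_zero'', mHalf_two hD, pcond_of_ne_zero hD one_ne_zero'',
      if_neg h.le.not_gt]

/-- **Definition by cases on a comparison** in every model of `PV₁`:
`sel (a, b, c, d) = c` if `a ≤ b`, `= d` otherwise (Cook 1975, §2; Krajíček 1995, §5.3).
[cite: Cook1975, §2] -/
theorem papp_sel (hM : M ⊨ PV1) (a b c d : M) :
    papp sel ![a, b, c, d] = if a ≤ b then c else d := by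
  have hD := model_PVdef_of_model_PV1 hM
  rw [sel, papp_ap₃ hD, papp_ap₂ hD, papp_proj hD, papp_proj hD, papp_proj hD, papp_proj hD]
  change pcond (papp leInd ![a, b]) d c = _
  rw [papp_leInd hM]
  split_ifs with h
  · exact pcond_of_ne_zero hD one_ne_zero'' d c
  · exact pcond_zero hD d c

/-- `sel (a, b, c, d) = c` if `a ≤ b`. [cite: Cook1975, §2] -/
theorem papp_sel_of_le' (hM : M ⊨ PV1) {a b : M} (h : a ≤ b) (c d : M) :
    papp sel ![a, b, c, d] = c := by rw [papp_sel hM, if_pos h]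

/-- `sel (a, b, c, d) = d` if `b < a`. [cite: Cook1975, §2] -/
theorem papp_sel_of_lt' (hM : M ⊨ PV1) {a b : M} (h : b < a) (c d : M) :
    papp sel ![a, b, c, d] = d := by rw [papp_sel hM, if_neg h.not_ge]

end Cmp

end PV1

end Literature.Analysis.FunctionSpaces
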